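import Literature.Geometry.Lorentzian.KerrSchildMultiplierCurrent
import Literature.Geometry.Lorentzian.MinkowskiRadialMultiplier
import Literature.Geometry.Lorentzian.KerrSchildHomogeneity
import Summits.FinalStateConjecture.FinalStateConjecture.Theorems.ClusterCompletenessAdiabaticMultiKerrILEDZonePumping

/-!
# Route ClusterCompleteness — crux `AdiabaticMultiKerrILED`: Euler identity with spin

Helper file for the crux `stmt-FinalStateConjecture-14310` (line `Sketch`, lead c6 wave 1, card
milne-hubble-current): the tails-cut Kerr zone term
`F_{M,a}^{μν}(x) = χ(r) · 2H · ℓ♯^μ ℓ♯^ν` (`r = Kerr.radius a x`, `H = Kerr.scalarH M a x`,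
`ℓ♯ = Kerr.nullVector a x`, `χ(s) = Real.smoothTransition (2 − s/(8M))`) is homogeneous under the
JOINT dilation `(x, a) ↦ (l • x, l a)`, `l > 0`, up to the explicit profile: `r ↦ l r`, `H ↦ H / l`,
`ℓ♯ ↦ ℓ♯` (`Kerr.radius_smul`, `Kerr.scalarH_smul`, `Kerr.nullVector_dilate`). Hence
`l ↦ F_{M,la}^{μν}(l x)` agrees near `l = 1` with `l ↦ χ(l r) · l⁻¹ · (2H ℓ♯^μ ℓ♯^ν)`, whose
derivative at `l = 1` is `(r χ'(r) − χ(r)) · 2H · ℓ♯^μ ℓ♯^ν`; this is the Euler identity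
`(x·∂ + a ∂_a) F^{μν} = (r χ' − χ) · 2H · ℓ♯ ⊗ ℓ♯`, the spin-`a` generalisation of
`fderiv_self_cruxZoneTerm_schwarzschild`. [folklore]
-/

noncomputable section

-- the doubled `FinalStateConjecture.FinalStateConjecture` path component trips dupNamespace
set_option linter.dupNamespace false

open scoped BigOperators Topology
open Filter Literature.Geometry.Lorentzian

namespace Summit.FinalStateConjecture.FinalStateConjecture.Theorems

/-- **Joint `(x, a)`-scaling of the crux zone term** (spin `a`): for `t > 0`,
`F_{M,ta}^{μν}(t x) = χ(t r) · t⁻¹ · (2H(x) ℓ♯^μ(x) ℓ♯^ν(x))`, `r = Kerr.radius a x`, by the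
degree-`1`, `−1`, `0` homogeneity of `r`, `H`, `ℓ♯` under `(x, a) ↦ (t x, t a)` (`Kerr.radius_smul`,
`Kerr.scalarH_smul` with `Kerr.scalarH_eq_mul_scalarH_one`, `Kerr.nullVector_dilate`;
Kerr–Schild 1965, §2). No positivity of the radius is needed: the homogeneity lemmas hold at every
point, junk values included. [folklore] -/
theorem spinDilate_cruxZoneTerm_smul (M a : ℝ) (x : E4) (μ ν : Fin 4) {t : ℝ} (ht : 0 < t) :
    Real.smoothTransition (2 - Kerr.radius (t * a) (t • x) / (8 * M)) *
        (2 * Kerr.scalarH M (t * a) (t • x)) * (Kerr.nullVector (t * a) (t • x)) μ *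
          (Kerr.nullVector (t * a) (t • x)) ν =
      (fun s : ℝ ↦ Real.smoothTransition (2 - s / (8 * M))) (t * Kerr.radius a x) * t⁻¹ *
        (2 * Kerr.scalarH M a x * (Kerr.nullVector a x) μ * (Kerr.nullVector a x) ν) := by
  have hr : Kerr.radius (t * a) (t • x) = t * Kerr.radius a x := Kerr.radius_smul ht a x
  have hl : Kerr.nullVector (t * a) (t • x) = Kerr.nullVector a x := Kerr.nullVector_dilate ht a x
  have hH : Kerr.scalarH M (t * a) (t • x) = t⁻¹ * Kerr.scalarH M a x := by
    rw [Kerr.scalarH_eq_mul_scalarH_one M (t * a) (t • x), ← Kerr.scalarH_smul ht M a x]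
    field_simp
  rw [hr, hl, hH]
  ring

/-- **Euler identity with spin for the tails-cut Kerr zone term.** For the crux zone term
`F_{M,a}^{μν}(x) = χ(r) · 2H · ℓ♯^μ ℓ♯^ν` (`r = Kerr.radius a x`, `H = Kerr.scalarH M a x`,
`ℓ♯ = Kerr.nullVector a x`, `χ(s) = Real.smoothTransition (2 − s/(8M))`) the derivative at `l = 1`
of the joint dilation `l ↦ F_{M,la}^{μν}(l x)` is `(r χ'(r) − χ(r)) · 2H · ℓ♯^μ ℓ♯^ν`: on the
neighbourhood `{l > 0}` of `1` the dilated term equals `χ(l r) · l⁻¹ · (2H ℓ♯^μ ℓ♯^ν)`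
(`spinDilate_cruxZoneTerm_smul`), whose derivative at `1` is computed by
`zonePumping_hasDerivAt_profile` (chain rule, `χ` smooth). This encodes
`(x·∂ + a ∂_a) F^{μν} = (r χ' − χ) · 2H · ℓ♯^μ ℓ♯^ν` (Kerr–Schild 1965, §2; Euler's identity).
[folklore] -/
theorem hasDerivAt_cruxZoneTerm_dilate :
    ∀ (M a : ℝ) (x : E4) (μ ν : Fin 4), HasDerivAt (fun l : ℝ ↦
      Real.smoothTransition (2 - Kerr.radius (l * a) (l • x) / (8 * M)) *
        (2 * Kerr.scalarH M (l * a) (l • x)) * (Kerr.nullVector (l * a) (l • x)) μ *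
          (Kerr.nullVector (l * a) (l • x)) ν)
      ((Kerr.radius a x * deriv (fun s ↦ Real.smoothTransition (2 - s / (8 * M))) (Kerr.radius a x)
            - Real.smoothTransition (2 - Kerr.radius a x / (8 * M))) * (2 * Kerr.scalarH M a x) *
        (Kerr.nullVector a x) μ * (Kerr.nullVector a x) ν) 1 := by
  intro M a x μ ν
  have key := zonePumping_hasDerivAt_profile (zonePumping_differentiable_cutoff M) (Kerr.radius a x)
    (2 * Kerr.scalarH M a x * (Kerr.nullVector a x) μ * (Kerr.nullVector a x) ν)
  refine (key.congr_of_eventuallyEq ?_).congr_deriv ?_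
  · filter_upwards [lt_mem_nhds one_pos] with t ht
    exact spinDilate_cruxZoneTerm_smul M a x μ ν ht
  · ring

end Summit.FinalStateConjecture.FinalStateConjecture.Theorems
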